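import Summits.ValiantsHypothesis.ValiantsHypothesis.Theorems.KPlusLogSqLawTropicalBLongCarries
import Summits.ValiantsHypothesis.ValiantsHypothesis.Theorems.LacunarySymmetroidMatrixDescartesCensusTropicalKLawStatic

/-!
# Route `KPlusLogSqLaw`, crux `TropicalB` — long carries in STATIC designs: pivots of the parametric assignment problem

HONEST FRAMING.  Support file toward the registered stubs of the crux `TropicalB` (ledger item `stmt-ValiantsHypothesis-19771`, route
`KPlusLogSqLaw`; cell `pub-symmetroid`, seat val-sym-trop-p4, 2026-08-26).  The static reading of `…TropicalBLongCarries`; nothing is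
asserted about `TropicalB` in general, `Lifting`, `KPlusLogSqLaw`, `MatrixDescartes` or `VP ≠ VNP`.

In a STATIC design (every entry carries at most one class — a plain K-slope parametric ASSIGNMENT instance) a column that keeps its
row keeps its class, so «columns changed at a step» = «columns MOVED at a step» = the length of the pivot (the alternating exchange
between consecutive optimal assignments).  Hence (`steps_le_longPivots_static`): in the lex regime (exponent values super-increasing by
the size), a dominant sign-alternating chain with `J` pivots moving more than `ℓ` columns has `n ≤ m·(J+1)·(ℓ+1)^K`.  By the port
embedding (`tropRootLawAt_of_static_ports`) this static form loses nothing: general designs are static ones at `K`-fold size.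

[folklore]
-/

-- `Summit.ValiantsHypothesis.ValiantsHypothesis.…` repeats a component by the D-0017 layout
-- (single-conjunct summit), which the `dupNamespace` linter flags; the name is mandated.
set_option linter.dupNamespace false
set_option autoImplicit false

namespace Summit.ValiantsHypothesis.ValiantsHypothesis.Theorems.LacunarySymmetroidMatrixDescartes.TropicalCensus

open Summit.ValiantsHypothesis.ValiantsHypothesis.Theorems.MatrixDescartes.Negative
open Finset

section LongCarriesStatic

variable {m K : ℕ}

/-- In a static design two PRESENT terms that use the same row at a column use the same class there. [folklore] -/
theorem class_eq_of_static_of_row_eq (ε : Fin m → Fin m → Fin K → ℤ) (hst : IsStatic ε)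
    (p q : Equiv.Perm (Fin m) × (Fin m → Fin K)) (hp : termSign ε p ≠ 0) (hq : termSign ε q ≠ 0) (i : Fin m)
    (hrow : p.1 i = q.1 i) : p.2 i = q.2 i := by
  have h1 := present_of_termSign_ne_zero ε p hp i
  have h2 := present_of_termSign_ne_zero ε q hq i
  rw [hrow] at h1
  exact hst _ _ _ _ h1 h2

/-- In a static design the columns CHANGED (row or class) between two present terms are exactly the columns MOVED (row). [folklore] -/
theorem filter_changed_eq_filter_moved_of_static (ε : Fin m → Fin m → Fin K → ℤ) (hst : IsStatic ε)
    (p q : Equiv.Perm (Fin m) × (Fin m → Fin K)) (hp : termSign ε p ≠ 0) (hq : termSign ε q ≠ 0) :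
    (univ.filter fun i : Fin m => p.1 i ≠ q.1 i ∨ p.2 i ≠ q.2 i) = (univ.filter fun i : Fin m => p.1 i ≠ q.1 i) := by
  ext i
  simp only [mem_filter, mem_univ, true_and]
  constructor
  · intro h
    rcases h with h | h
    · exact h
    · intro hrow; exact h (class_eq_of_static_of_row_eq ε hst p q hp hq i hrow)
  · exact fun h => Or.inl h

/-- **LONG PIVOTS PAY FOR THE CHAIN (static designs, lex regime).**  For a static design whose exponent values are super-increasing
by the size, along every dominant sign-alternating chain: `n ≤ m·(J+1)·(ℓ+1)^K` where `J` is the number of steps whose pivot MOVES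
more than `ℓ` columns (`ℓ ≥ 1`). [folklore] -/
theorem steps_le_longPivots_static (d : Fin K → ℕ) (hsup : ∀ l l' : Fin K, d l < d l' → m * d l < d l')
    (v ε : Fin m → Fin m → Fin K → ℤ) (hst : IsStatic ε) {n : ℕ} (θ : Fin (n + 1) → ℤ)
    (p : Fin (n + 1) → Equiv.Perm (Fin m) × (Fin m → Fin K)) (hθ : StrictMono θ)
    (hdom : ∀ k, IsDominant d v ε (θ k) (p k))
    (halt : ∀ k : Fin n, termSign ε (p k.castSucc) * termSign ε (p k.succ) < 0) (ℓ : ℕ) (hℓ1 : 1 ≤ ℓ) :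
    n ≤ m * ((univ.filter fun k : Fin n => ℓ < (univ.filter fun i : Fin m =>
        (p k.castSucc).1 i ≠ (p k.succ).1 i).card).card + 1) * (ℓ + 1) ^ K := by
  have h := steps_le_longCarries d hsup v ε θ p hθ hdom halt ℓ hℓ1
  have heq : ∀ k : Fin n, (univ.filter fun i : Fin m =>
      (p k.castSucc).1 i ≠ (p k.succ).1 i ∨ (p k.castSucc).2 i ≠ (p k.succ).2 i) =
      (univ.filter fun i : Fin m => (p k.castSucc).1 i ≠ (p k.succ).1 i) :=
    fun k => filter_changed_eq_filter_moved_of_static ε hst _ _ (hdom k.castSucc).1 (hdom k.succ).1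
  simp only [heq] at h
  exact h

end LongCarriesStatic

end Summit.ValiantsHypothesis.ValiantsHypothesis.Theorems.LacunarySymmetroidMatrixDescartes.TropicalCensus
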